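import Summits.QuantumAdvantage.AdviceFreeQNC0.CleanGapStrategies
import HarnessLib

/-!
# The GAP-3 LAW `GapLawThreeG` (planner qa-qnc0-p2 g15, ROUND-15 §3.14): not reading a 3-window costs a quarter of the inputs

Statement VERBATIM from `HOME/qa-qnc0-p2/line15/SketchGap.lean` (`GapLawG`, `GapLawThreeG`): in the tree's `glue3` frame
`u = a ++ v ++ b` (`|v| = 3`), a strategy of α's u-walk game NONE of whose cuts reads the window bits (hypothesis `hloc`
only — the cuts strictly INSIDE the window MAY fire, which is what global juntas need; the silent case is the tree's
`ringWinU_cleanGap_le`) wins on at most `(3/4)·2ⁿ` inputs: `4·#WIN ≤ 3·2^{p+3+q}` (**`gapLawThreeG`**; SHARP, p2's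
exhaustive run model: `μ*_3 = 1/4`, 96/128 attained at n = 7).

PROOF (p2's conditioning argument = "twisted frame, run model of length 3").  Fix the outside blocks `(a, b)`; every
selector is then a constant `gapSel y a b g`.  For a cut `g ≤ p` the walk character is `A_g + |v|`, for `g ≥ p + 3` it is
`C_g + 2|v|` (`gapChar` of `CleanGapStrategies`), so the OUTSIDE cuts contribute the parity `f(|v| mod 3)` of
`N_out(r) = #{g outside, selected, gapChar(g, r) ≢ 0}`, and `f(0) ⊕ f(1) ⊕ f(2) = 0` because every position's character is
non-zero for exactly two residues (`sum_range_three_gapChar_ne`).  The two INTERIOR cuts `p+1`, `p+2` have characters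
`κ + |v| + v₀` and `κ + 1 + |v| + v₀ + v₁` (`κ = c + p + 1 + 2|a| + |b|`).  So on the fibre
`WIN(v) = runWin3 f s κ v` (`ringWinU_glue3_eq_runWin3`), and the RUN MODEL fact
`#{v ∈ {0,1}³ : runWin3 f s κ v} ≤ 6` for every even-parity `f`, selectors `s`, offset `κ` is `decide`d (`runWin3_card_le`;
the coupling "second interior offset = first + 1" is essential — with independent offsets the maximum is 7).
Fubini over `(a, b)` (`card_filter_eq_sum_glue3`).
WHAT THIS IS NOT: orthogonal to the dense crux (dense strategies have no unread window); degree-free instrument; separation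
NOT moved.  The general-`m` law `GapLawConj` (μ*_m = 1/3 − (4/3)2^{−m}) is not attempted.
-/

namespace Summit.QuantumAdvantage.AdviceFreeQNC0

open Finset

/-! ## §1 Statements (planner qa-qnc0-p2 g15 `line15/SketchGap.lean`, verbatim) -/

/-- **THE GAP LAW in the tree's `glue3` frame** (`CleanGapStrategies`): only `hloc` (the window is not read; cuts inside MAY fire). -/
def GapLawG (ℓ num den : ℕ) : Prop :=
  ∀ (p q c : ℕ) (y : Fin (p + ℓ + q + 1) → (Fin (p + ℓ + q) → Bool) → Bool),
    (∀ (g : Fin (p + ℓ + q + 1)) (a : Fin p → Bool) (v v' : Fin ℓ → Bool) (b : Fin q → Bool),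
      y g (glue3 a v b) = y g (glue3 a v' b)) →
      den * (Finset.univ.filter fun w : Fin (p + ℓ + q) → Bool => ringWinU c y w = true).card ≤ (den - num) * 2 ^ (p + ℓ + q)

/-- `GapLawG 3 1 4`: not reading a 3-window costs a quarter of the inputs, whatever the cuts inside it do. -/
def GapLawThreeG : Prop := GapLawG 3 1 4

/-! ## §2 The run model of length 3 -/

namespace GapThree

/-- the weight of a 3-word. -/
def wt3 (v : Fin 3 → Bool) : ℕ := (v 0).toNat + (v 1).toNat + (v 2).toNat

/-- the parity pattern of the outside cuts, read at the window weight. -/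
def fSel (f0 f1 f2 : Bool) (w : ℕ) : Bool := if w % 3 = 0 then f0 else if w % 3 = 1 then f1 else f2

/-- **the run model**: WIN bit on the fibre as a function of the window word `v` — outside parity `f(|v|)`, interior cut
`p+1` (selector `s1`, character `κ + |v| + v₀`), interior cut `p+2` (selector `s2`, character `κ + 1 + |v| + v₀ + v₁`). -/
def runWin3 (f0 f1 f2 s1 s2 : Bool) (κ : ℕ) (v : Fin 3 → Bool) : Bool :=
  xor (fSel f0 f1 f2 (wt3 v))
    (xor (s1 && decide ((κ + wt3 v + (v 0).toNat) % 3 ≠ 0))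
      (s2 && decide ((κ + 1 + wt3 v + (v 0).toNat + (v 1).toNat) % 3 ≠ 0)))

/-- **RUN-MODEL BOUND** (`RunModelBound 3 1 4` of the planner, in this encoding): every even-parity outside pattern, every
interior selection and every offset win on at most 6 of the 8 window words. -/
theorem runWin3_card_le : ∀ (f0 f1 f2 s1 s2 : Bool) (κ : Fin 3), xor f0 (xor f1 f2) = false →
    (univ.filter fun v : Fin 3 → Bool => runWin3 f0 f1 f2 s1 s2 κ.val v = true).card ≤ 6 := by
  decide

/-- the run model reads the offset mod 3. -/
theorem runWin3_mod (f0 f1 f2 s1 s2 : Bool) (κ : ℕ) (v : Fin 3 → Bool) :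
    runWin3 f0 f1 f2 s1 s2 κ v = runWin3 f0 f1 f2 s1 s2 (κ % 3) v := by
  unfold runWin3
  have h1 : (κ + wt3 v + (v 0).toNat) % 3 = (κ % 3 + wt3 v + (v 0).toNat) % 3 := by omega
  have h2 : (κ + 1 + wt3 v + (v 0).toNat + (v 1).toNat) % 3 = (κ % 3 + 1 + wt3 v + (v 0).toNat + (v 1).toNat) % 3 := by
    omega
  rw [h1, h2]

/-- `wt3` is the weight. -/
theorem wt_eq_wt3 : ∀ v : Fin 3 → Bool, wt v = wt3 v := by decide

/-- prefix weights of a 3-word. -/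
theorem wtPrefix_three_one : ∀ v : Fin 3 → Bool, wtPrefix v 1 = (v 0).toNat := by decide

/-- prefix weights of a 3-word. -/
theorem wtPrefix_three_two : ∀ v : Fin 3 → Bool, wtPrefix v 2 = (v 0).toNat + (v 1).toNat := by decide

/-! ## §3 The fibre normal form -/

section Fibre

variable {p q : ℕ} (c : ℕ) (y : Fin (p + 3 + q + 1) → (Fin (p + 3 + q) → Bool) → Bool)
  (a : Fin p → Bool) (b : Fin q → Bool)

/-- a cut strictly inside the window (`abbrev`, so that filters find the `Decidable` instance). -/
abbrev Interior (g : Fin (p + 3 + q + 1)) : Prop := g.val = p + 1 ∨ g.val = p + 2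

/-- `N_out(r)`: selected OUTSIDE cuts whose character with window-weight parameter `r` is non-zero. -/
def outCount (r : ℕ) : ℕ :=
  (univ.filter fun g : Fin (p + 3 + q + 1) =>
    ¬ Interior g ∧ gapSel y a b g = true ∧ gapChar 3 c a b g.val r % 3 ≠ 0).card

/-- `N_out(r)` reads `r mod 3`. -/
theorem outCount_mod (r : ℕ) : outCount c y a b r = outCount c y a b (r % 3) := by
  unfold outCount
  congr 1
  refine filter_congr fun g _ => ?_
  rw [gapChar_mod 3 c a b g.val r]

/-- **parity of the outside pattern**: `N_out(0) + N_out(1) + N_out(2)` is even (each cut's character vanishes for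
exactly one residue). -/
theorem outCount_sum_even : (outCount c y a b 0 + outCount c y a b 1 + outCount c y a b 2) % 2 = 0 := by
  have h : ∑ r ∈ range 3, outCount c y a b r
      = 2 * (univ.filter fun g : Fin (p + 3 + q + 1) => ¬ Interior g ∧ gapSel y a b g = true).card := by
    unfold outCount
    simp only [card_filter]
    rw [sum_comm, mul_sum]
    refine sum_congr rfl fun g _ => ?_
    by_cases hg : ¬ Interior g ∧ gapSel y a b g = true
    · obtain ⟨hg1, hg2⟩ := hg
      rw [if_pos ⟨hg1, hg2⟩, mul_one]
      refine Eq.trans (sum_congr rfl fun r _ => ?_) (sum_range_three_gapChar_ne 3 c a b g.val)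
      by_cases hr : gapChar 3 c a b g.val r % 3 ≠ 0
      · rw [if_pos ⟨hg1, hg2, hr⟩, if_pos hr]
      · rw [if_neg (fun h => hr h.2.2), if_neg hr]
    · rw [if_neg hg, mul_zero]
      exact sum_eq_zero fun r _ => if_neg fun h => hg ⟨h.1, h.2.1⟩
  rw [sum_range_succ, sum_range_succ, sum_range_succ, sum_range_zero, zero_add] at h
  omega

/-- the outside parity pattern as Booleans. -/
noncomputable def fOut (r : ℕ) : Bool := decide (outCount c y a b r % 2 = 1)

/-- the outside pattern has even parity. -/
theorem fOut_parity : xor (fOut c y a b 0) (xor (fOut c y a b 1) (fOut c y a b 2)) = false := by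
  unfold fOut
  have h := outCount_sum_even c y a b
  rcases Nat.mod_two_eq_zero_or_one (outCount c y a b 0) with h0 | h0 <;>
    rcases Nat.mod_two_eq_zero_or_one (outCount c y a b 1) with h1 | h1 <;>
      rcases Nat.mod_two_eq_zero_or_one (outCount c y a b 2) with h2 | h2 <;>
        simp [h0, h1, h2] <;> omega

/-- the interior offset `κ = c + p + 1 + 2|a| + |b|`. -/
def kap : ℕ := c + p + 1 + 2 * wt a + wt b

/-- the two interior cuts. -/
def cut1 : Fin (p + 3 + q + 1) := ⟨p + 1, by omega⟩
/-- the two interior cuts. -/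
def cut2 : Fin (p + 3 + q + 1) := ⟨p + 2, by omega⟩

/-- **THE FIBRE NORMAL FORM**: on `a ++ v ++ b` the game is the run model. -/
theorem ringWinU_glue3_eq_runWin3
    (hloc : ∀ (g : Fin (p + 3 + q + 1)) (a : Fin p → Bool) (v v' : Fin 3 → Bool) (b : Fin q → Bool),
      y g (glue3 a v b) = y g (glue3 a v' b))
    (v : Fin 3 → Bool) :
    ringWinU c y (glue3 a v b)
      = runWin3 (fOut c y a b 0) (fOut c y a b 1) (fOut c y a b 2)
          (gapSel y a b (cut1 (p := p) (q := q))) (gapSel y a b (cut2 (p := p) (q := q))) (kap c a b) v := by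
  -- the selected-and-nonzero set, split into outside / cut1 / cut2
  have hsel : ∀ g, y g (glue3 a v b) = gapSel y a b g := fun g => hloc g a v (fun _ => false) b
  set S := univ.filter fun g : Fin (p + 3 + q + 1) =>
    y g (glue3 a v b) = true ∧ (c + g.val + walkExp (glue3 a v b) g.val) % 3 ≠ 0 with hS
  -- outside part
  have hchar : ∀ g : Fin (p + 3 + q + 1), ¬ Interior g →
      c + g.val + walkExp (glue3 a v b) g.val = gapChar 3 c a b g.val (wt v) := by
    intro g hg
    unfold Interior at hg
    unfold walkExp gapChar
    by_cases hle : g.val ≤ p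
    · rw [if_pos hle, wtPrefix_glue3_of_le a v b hle, wt_glue3]
    · have hge : p + 3 ≤ g.val := by omega
      rw [if_neg hle, wtPrefix_glue3_of_ge a v b hge, wt_glue3]
  have hout : (S.filter fun g => ¬ Interior g).card = outCount c y a b (wt v) := by
    unfold outCount
    rw [hS, filter_filter]
    congr 1
    refine filter_congr fun g _ => ?_
    constructor
    · rintro ⟨⟨h1, h2⟩, h3⟩
      exact ⟨h3, by rw [← hsel]; exact h1, by rw [← hchar g h3]; exact h2⟩
    · rintro ⟨h3, h1, h2⟩
      exact ⟨⟨by rw [hsel]; exact h1, by rw [hchar g h3]; exact h2⟩, h3⟩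
  -- interior characters
  have hw1 : walkExp (glue3 a v b) (p + 1) = wt a + wt v + wt b + (wt a + (v 0).toNat) := by
    unfold walkExp glue3
    rw [wt_append, wt_append, wtPrefix_append_of_le _ _ (by omega : p + 1 ≤ p + 3),
      wtPrefix_append_of_ge _ _ (by omega : p ≤ p + 1), show p + 1 - p = 1 by omega, wtPrefix_three_one]
  have hw2 : walkExp (glue3 a v b) (p + 2) = wt a + wt v + wt b + (wt a + ((v 0).toNat + (v 1).toNat)) := by
    unfold walkExp glue3
    rw [wt_append, wt_append, wtPrefix_append_of_le _ _ (by omega : p + 2 ≤ p + 3),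
      wtPrefix_append_of_ge _ _ (by omega : p ≤ p + 2), show p + 2 - p = 2 by omega, wtPrefix_three_two]
  have hin1 : (S.filter fun g => g = cut1).card
      = (gapSel y a b (cut1 (p := p) (q := q)) && decide ((kap c a b + wt3 v + (v 0).toNat) % 3 ≠ 0)).toNat := by
    rw [hS, filter_filter, show (univ.filter fun g : Fin (p + 3 + q + 1) =>
        (y g (glue3 a v b) = true ∧ (c + g.val + walkExp (glue3 a v b) g.val) % 3 ≠ 0) ∧ g = cut1)
        = univ.filter fun g => g = cut1 ∧ (gapSel y a b (cut1 (p := p) (q := q)) = true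
          ∧ (kap c a b + wt3 v + (v 0).toNat) % 3 ≠ 0) from ?_]
    · rw [filter_and, filter_eq' univ, if_pos (mem_univ _)]
      by_cases h : gapSel y a b (cut1 (p := p) (q := q)) = true ∧ (kap c a b + wt3 v + (v 0).toNat) % 3 ≠ 0
      · rw [filter_true_of_mem (fun _ _ => h)]
        simp [h]
      · rw [filter_false_of_mem (fun _ _ => h)]
        simp only [inter_empty, card_empty]
        rw [not_and_or] at h
        rcases h with h | h
        · simp [h]
        · simp [h]
    · refine filter_congr fun g _ => ?_
      constructor
      · rintro ⟨⟨h1, h2⟩, rfl⟩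
        refine ⟨rfl, by rw [← hsel]; exact h1, ?_⟩
        simp only [cut1] at h2
        rw [hw1, wt_eq_wt3] at h2
        unfold kap; intro h; apply h2; omega
      · rintro ⟨rfl, h1, h2⟩
        refine ⟨⟨by rw [hsel]; exact h1, ?_⟩, rfl⟩
        simp only [cut1]
        rw [hw1, wt_eq_wt3]
        unfold kap at h2; intro h; apply h2; omega
  have hin2 : (S.filter fun g => g = cut2).card
      = (gapSel y a b (cut2 (p := p) (q := q))
          && decide ((kap c a b + 1 + wt3 v + (v 0).toNat + (v 1).toNat) % 3 ≠ 0)).toNat := by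
    rw [hS, filter_filter, show (univ.filter fun g : Fin (p + 3 + q + 1) =>
        (y g (glue3 a v b) = true ∧ (c + g.val + walkExp (glue3 a v b) g.val) % 3 ≠ 0) ∧ g = cut2)
        = univ.filter fun g => g = cut2 ∧ (gapSel y a b (cut2 (p := p) (q := q)) = true
          ∧ (kap c a b + 1 + wt3 v + (v 0).toNat + (v 1).toNat) % 3 ≠ 0) from ?_]
    · rw [filter_and, filter_eq' univ, if_pos (mem_univ _)]
      by_cases h : gapSel y a b (cut2 (p := p) (q := q)) = true
          ∧ (kap c a b + 1 + wt3 v + (v 0).toNat + (v 1).toNat) % 3 ≠ 0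
      · rw [filter_true_of_mem (fun _ _ => h)]
        simp [h]
      · rw [filter_false_of_mem (fun _ _ => h)]
        simp only [inter_empty, card_empty]
        rw [not_and_or] at h
        rcases h with h | h
        · simp [h]
        · simp [h]
    · refine filter_congr fun g _ => ?_
      constructor
      · rintro ⟨⟨h1, h2⟩, rfl⟩
        refine ⟨rfl, by rw [← hsel]; exact h1, ?_⟩
        simp only [cut2] at h2
        rw [hw2, wt_eq_wt3] at h2
        unfold kap; intro h; apply h2; omega
      · rintro ⟨rfl, h1, h2⟩
        refine ⟨⟨by rw [hsel]; exact h1, ?_⟩, rfl⟩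
        simp only [cut2]
        rw [hw2, wt_eq_wt3]
        unfold kap at h2; intro h; apply h2; omega
  -- the three parts exhaust S
  have hInt : ∀ g : Fin (p + 3 + q + 1), Interior g ↔ (g = cut1 ∨ g = cut2) := by
    intro g; simp only [Interior, cut1, cut2, Fin.ext_iff]
  have hsplit : S.card = (S.filter fun g => ¬ Interior g).card
      + ((S.filter fun g => g = cut1).card + (S.filter fun g => g = cut2).card) := by
    rw [← card_filter_add_card_filter_not (s := S) (fun g => ¬ Interior g)]
    congr 1
    have e : (S.filter fun g => ¬ ¬ Interior g) = S.filter (fun g => g = cut1) ∪ S.filter (fun g => g = cut2) := by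
      rw [← filter_or]; refine filter_congr fun g _ => ?_; rw [not_not, hInt]
    rw [e, card_union_of_disjoint]
    rw [disjoint_filter]
    rintro g _ h1 h2
    rw [h1] at h2
    exact absurd (congrArg Fin.val h2) (by simp [cut1, cut2])
  -- assemble: parity bookkeeping
  have hpar : ∀ (N : ℕ) (B1 B2 : Bool),
      decide ((N + (B1.toNat + B2.toNat)) % 2 = 1) = xor (decide (N % 2 = 1)) (xor B1 B2) := by
    intro N B1 B2
    rcases Nat.mod_two_eq_zero_or_one N with h | h <;> cases B1 <;> cases B2 <;> simp [h, Nat.add_mod]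
  have hf : fSel (fOut c y a b 0) (fOut c y a b 1) (fOut c y a b 2) (wt3 v) = decide (outCount c y a b (wt v) % 2 = 1) := by
    unfold fSel fOut
    rw [outCount_mod c y a b (wt v), wt_eq_wt3]
    have hr : wt3 v % 3 = 0 ∨ wt3 v % 3 = 1 ∨ wt3 v % 3 = 2 := by omega
    rcases hr with hr | hr | hr <;> simp [hr]
  unfold ringWinU runWin3
  rw [← hS, hsplit, hout, hin1, hin2, hf, hpar]

/-- **fibre bound**: on every fibre `{a ++ v ++ b : v}` the strategy wins on at most 6 of the 8 window words. -/
theorem card_win_fibre_le_six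
    (hloc : ∀ (g : Fin (p + 3 + q + 1)) (a : Fin p → Bool) (v v' : Fin 3 → Bool) (b : Fin q → Bool),
      y g (glue3 a v b) = y g (glue3 a v' b)) :
    (univ.filter fun v : Fin 3 → Bool => ringWinU c y (glue3 a v b) = true).card ≤ 6 := by
  have hk := runWin3_card_le (fOut c y a b 0) (fOut c y a b 1) (fOut c y a b 2)
    (gapSel y a b (cut1 (p := p) (q := q))) (gapSel y a b (cut2 (p := p) (q := q)))
    ⟨kap c a b % 3, Nat.mod_lt _ (by norm_num)⟩ (fOut_parity c y a b)
  refine le_trans (le_of_eq ?_) hk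
  congr 1
  refine filter_congr fun v _ => ?_
  rw [ringWinU_glue3_eq_runWin3 c y a b hloc v, runWin3_mod]

end Fibre

end GapThree

/-! ## §4 The law -/

/-- **`GapLawThreeG` — PROVED**: not reading a 3-window costs a quarter of the inputs (`4·#WIN ≤ 3·2ⁿ`), whatever the two
cuts inside the window do. -/
theorem gapLawThreeG : GapLawThreeG := by
  intro p q c y hloc
  show 4 * _ ≤ (4 - 1) * 2 ^ (p + 3 + q)
  rw [card_filter_eq_sum_glue3, mul_sum]
  calc ∑ a : Fin p → Bool, 4 * ∑ b : Fin q → Bool,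
        (univ.filter fun v : Fin 3 → Bool => ringWinU c y (glue3 a v b) = true).card
      ≤ ∑ _a : Fin p → Bool, ∑ _b : Fin q → Bool, 24 := by
        refine sum_le_sum fun a _ => ?_
        rw [mul_sum]
        exact sum_le_sum fun b _ => by linarith [GapThree.card_win_fibre_le_six c y a b hloc]
    _ = (4 - 1) * 2 ^ (p + 3 + q) := by
        rw [sum_const, sum_const, card_univ, card_univ, Fintype.card_fun, Fintype.card_fun, Fintype.card_bool,
          Fintype.card_fin, Fintype.card_fin, smul_eq_mul, smul_eq_mul]
        ring

end Summit.QuantumAdvantage.AdviceFreeQNC0
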